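import Summits.HodgeConjecture.HodgeConjecture.Theorems.VHCAbelianSchemesRoadEllipticTensorWeilAnchors
import Summits.HodgeConjecture.HodgeConjecture.Theorems.Ring2DeformCompactPencils
import Summits.HodgeConjecture.HodgeConjecture.Theses.VHCAbelianSchemesRoad
import HarnessLib

/-!
# Ring 2 / AbelianAll (André column) — `HC_CM` FROM TWISTED CARRIERS FOR `E`-WEIL CLASSES AT TENSOR POINTS OVER ONE ELLIPTIC CURVE; `HC_AV` WITH
# `HC_CM` IDLE — the rows of PART AC-f on the cell's named decls (leaf file)

research route, not a corollary; conditional on HC_CM plus one named minimal statement.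

LEAF FILE (imports the road's route file; nothing should import it). PART AB-f's rows (`HC_CM_of_ellipticPowerAlgebraicTwistedCarriers`,
`HC_AV_of_cmAlgebraic_and_ellipticPower_twistedCarriers`) asked carriers for ALL algebraic classes on powers of EVERY elliptic curve. With the
Weil-tensor fact `Andre1996.andre1996_cmHodgeClasses_weilTensorPencils` (Lemme 6.3.3's special fibre = the tensor point `V₀ ⊗ E` over a PRESCRIBED
`E₀`, extended class an `E`-Weil class) and the road-side file `VHCAbelianSchemesRoadEllipticTensorWeilAnchors`, the node shrinks to
`EllipticTensorWeilCarriers 𝒪 E₀` / `EllipticTensorWeilTwistedCarriers E₀` (PART AC-f Defs): carriers for the `[E:ℚ]`-dimensional spaces of `E`-WEIL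
classes of CM-field structures, on powers of ONE elliptic curve of our choice. This file states the rows on the NAMED decls:

* §1 **`HC_CM_of_ellipticTensorWeilTwistedCarriers : K-C → TwistedPerfectDoor → andre1996_cmHodgeClasses_weilTensorPencils → E₀.dim = 1 →
  EllipticTensorWeilTwistedCarriers E₀ → HC_CM`** (door-generic form first).
* §2 **`HC_AV_of_cmAlgebraic_and_ellipticTensorWeil_twistedCarriers : K-C → TwistedPerfectDoor → AndreCMAnchoredPencil →
  andre1996_cmHodgeClasses_weilTensorPencils → CMAlgebraicTwistedCarriers → E₀.dim = 1 → EllipticTensorWeilTwistedCarriers E₀ → HC_AV`** — the André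
  column's `B_min` of gen 60 with `HC_CM` IDLE: carriers for KNOWN ALGEBRAIC classes at CM anchors (`2 ≤ p`, `2p + 4 ≤ n`) and for `E`-WEIL classes at
  tensor points over ONE elliptic curve (`2 ≤ p ≤ n − 2`); no cell, no curve residual.
* §3 Lattice: `EllipticPowerAlgebraicCarriers 𝒪 ⟹ EllipticTensorWeilCarriers 𝒪 E₀` for every elliptic `E₀` (road-side §3), twisted form; hence from
  `AbelianDesigns 𝒪`; so §§1–2 REFINE AB-f's rows (smaller served sets, one curve) granted the Weil-tensor fact.
* §4 The Weil-tensor fact discharges the road's binder #22 (`andreAnchoredPencilsAlgebraic_of_weilTensorPencils`).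

HONEST: every carrier node is OPEN, not in print and NOT implied by the Hodge conjecture; `andre1996_cmHodgeClasses_weilTensorPencils` is a THEOREM IN
PRINT entering BY NAME (not a route binder); Lemme 6.3.1 and the door are the road's binders (door labels: route file + RING2-MAP §AbelianAll AA2.487).
Nothing here says any carrier, door, `HC_CM`, `HC_AV` or HC holds. References: [cite: Andre1996Motifs, §6.3 Lemmes 6.3.1–6.3.3 and proof of 6.3.3 (pp. 31–33)]
[cite: vanGeemen1994HodgeAV, 4.9, Lemma 3.7 and Thm. 4.3] [cite: MoonenZarhin1998WeilClasses, §1] [cite: Bloch1972Semiregularity, Remark (7.5)]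
[cite: BuchweitzFlenner2003, §5 Thm. 5.1] [cite: Pridham2024Semiregularity, Cor. 2.25 and Rem. 2.26–2.27] [cite: Milne1999, §7 p. 72].
-/

noncomputable section

open CategoryTheory CategoryTheory.Limits AlgebraicGeometry Topology

namespace Summit.HodgeConjecture.HodgeConjecture.Ring2.AbelianAll

-- the cell's namespace repeats the summit name (`Summit.HodgeConjecture.HodgeConjecture…`), as in every `Ring2*` file
set_option linter.dupNamespace false

open Literature.AlgebraicGeometry Literature.AlgebraicGeometry.Motives
open Literature.AlgebraicGeometry.HodgeTheory
open Literature.AlgebraicTopology.SingularHomology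
open Literature.AlgebraicGeometry.Milne1999 (IsOfCMType CMHodgeHypothesisAt)
open Literature.AlgebraicGeometry.Andre1996 (andre1996_cmAnchoredPencil andre1996_cmHodgeClasses_weilTensorPencils)
open Summit.Ventures.HSemireg (ObjClass LocalVariationalHodgeFor)
open Summit.HodgeConjecture.HodgeConjecture.Theses
open Summit.HodgeConjecture.HodgeConjecture.Ring2.SemiregularRepresentatives (AnchoredCarrierAt
  twistedPerfectDoorVHC_iff_localVariationalHodgeFor cmHodgeHypothesisAt_of_weilTensorPencils_of_door_of_anchoredCarrierAt
  forall_hodgeConjectureFor_of_andre1996_of_weilTensorPencils_of_door_of_carriers weilTensorCarrierAt_of_ellipticPowerAlgebraicCarrierAt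
  andre1996_cmHodgeClasses_algebraicallyAnchoredPencils_of_weilTensorPencils ellipticPowerAlgebraicCarrierAt_of_pinnedDesignAt)

/-! ## §1 `HC_CM` from carriers for `E`-Weil classes at tensor points over one elliptic curve -/

/-- **`HC_CM` from the Weil-tensor fact, the door's local variational Hodge statement and CARRIERS FOR `E`-WEIL CLASSES AT TENSOR POINTS OVER ONE
ELLIPTIC CURVE `E₀`** (door-generic; cell-free; residual-free). [cite: Andre1996Motifs, Lemme 6.3.3 and proof (p. 33), §6.3 b), c)]
[cite: MoonenZarhin1998WeilClasses, §1] [cite: BuchweitzFlenner2003, §5 Thm. 5.1] [cite: Milne1999, §7 p. 72] -/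
theorem HC_CM_of_weilTensorPencils_of_door_of_ellipticTensorWeilCarriers (h₂₂ : andre1996_cmHodgeClasses_weilTensorPencils)
    {𝒪 : ObjClass} (hT : LocalVariationalHodgeFor 𝒪) {E₀ : AbelianVariety ℂ} (hE₀ : E₀.dim = 1) (hB : EllipticTensorWeilCarriers 𝒪 E₀) :
    RankFourFaces.CMAbelianHodge :=
  fun B hB' hcm ↦ cmHodgeHypothesisAt_of_weilTensorPencils_of_door_of_anchoredCarrierAt h₂₂ hT hE₀ (fun d p h2 h4 ↦ hB d p h2 h4) B hB' hcm

/-- **`HC_CM ⟸ K-C ∧ TwistedPerfectDoor ∧ andre1996_cmHodgeClasses_weilTensorPencils ∧ (ONE elliptic curve E₀) ∧ EllipticTensorWeilTwistedCarriers E₀`**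
— the road's binders BY NAME, the Weil-tensor fact BY NAME, and the node of PART AC-f: the Hodge conjecture for CM abelian varieties from semiregular
TWISTED representatives, modulo the `θ`-ray, of `E`-WEIL classes of CM-field structures on abelian varieties isogenous to powers of one elliptic
curve of our choice. [cite: Andre1996Motifs, Lemme 6.3.3 and proof (p. 33)] [cite: Pridham2024Semiregularity, Cor. 2.25 and Rem. 2.26–2.27]
[cite: MoonenZarhin1998WeilClasses, §1] [cite: Bloch1972Semiregularity, Remark (7.5)] -/
theorem HC_CM_of_ellipticTensorWeilTwistedCarriers (hC : VHCAbelianSchemesRoad.ChernCharacterOnBetti)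
    (hDoor : VHCAbelianSchemesRoad.TwistedPerfectDoor) (h₂₂ : andre1996_cmHodgeClasses_weilTensorPencils) {E₀ : AbelianVariety ℂ}
    (hE₀ : E₀.dim = 1) (hB : EllipticTensorWeilTwistedCarriers E₀) : RankFourFaces.CMAbelianHodge := by
  obtain ⟨C⟩ := (hC : Nonempty ChernCharacterBetti)
  exact HC_CM_of_weilTensorPencils_of_door_of_ellipticTensorWeilCarriers h₂₂
    ((twistedPerfectDoorVHC_iff_localVariationalHodgeFor C _).1 (hDoor C)) hE₀ (hB C)

/-! ## §2 `HC_AV` from CM-algebraic carriers and Weil-tensor carriers over one elliptic curve, `HC_CM` idle -/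

/-- **`HC_AV` from Lemme 6.3.1, the Weil-tensor fact, the door, CM-algebraic carriers and Weil-tensor carriers over one elliptic curve** (door-generic;
`HC_CM` is the intermediate conclusion of §1). [cite: Andre1996Motifs, §6.3 Lemmes 6.3.1–6.3.3 (pp. 31–33)] [cite: Bloch1972Semiregularity, Remark (7.5)]
[cite: Milne1999, §7 p. 72] -/
theorem HC_AV_of_andre1996_of_door_of_cmAlgebraic_of_ellipticTensorWeilCarriers (h₂₁ : andre1996_cmAnchoredPencil)
    (h₂₂ : andre1996_cmHodgeClasses_weilTensorPencils) {𝒪 : ObjClass} (hT : LocalVariationalHodgeFor 𝒪) (hcm : CMAlgebraicCarriers 𝒪)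
    {E₀ : AbelianVariety ℂ} (hE₀ : E₀.dim = 1) (hell : EllipticTensorWeilCarriers 𝒪 E₀) : PadicSemiregularLift.HodgeAbelianVarieties :=
  fun A ↦ forall_hodgeConjectureFor_of_andre1996_of_weilTensorPencils_of_door_of_carriers h₂₁ h₂₂ hT (fun n p h2 h4 ↦ hcm n p h2 h4) hE₀
    (fun d p h2 h4 ↦ hell d p h2 h4) A

/-- **`HC_AV ⟸ K-C ∧ TwistedPerfectDoor ∧ AndreCMAnchoredPencil ∧ andre1996_cmHodgeClasses_weilTensorPencils ∧ CMAlgebraicTwistedCarriers ∧ (ONE elliptic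
curve E₀) ∧ EllipticTensorWeilTwistedCarriers E₀`** — THE ANDRÉ COLUMN'S `B_min` OF GEN 60: semiregular twisted representatives, modulo the `θ`-ray, of
KNOWN ALGEBRAIC classes (i) of codimension `2 ≤ p`, `2p + 4 ≤ n` on polarised CM abelian `n`-folds and (ii) of the RATIONAL `E`-WEIL classes of
CM-field structures (per structure a space of dimension `[E:ℚ]`) in codimension `2 ≤ p ≤ n − 2` on polarised abelian `n`-folds isogenous to powers of
ONE elliptic curve `E₀` of our choice. `HC_CM` IDLE; no cell of K-SR♭∃; no curve residual. [cite: Andre1996Motifs, §6.3 (pp. 31–33)]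
[cite: Pridham2024Semiregularity, Cor. 2.25 and Rem. 2.26–2.27] [cite: MoonenZarhin1998WeilClasses, §1] [cite: Bloch1972Semiregularity, Remark (7.5)] -/
theorem HC_AV_of_cmAlgebraic_and_ellipticTensorWeil_twistedCarriers (hC : VHCAbelianSchemesRoad.ChernCharacterOnBetti)
    (hDoor : VHCAbelianSchemesRoad.TwistedPerfectDoor) (h₂₁ : VHCAbelianSchemesRoad.AndreCMAnchoredPencil)
    (h₂₂ : andre1996_cmHodgeClasses_weilTensorPencils) (hcm : CMAlgebraicTwistedCarriers) {E₀ : AbelianVariety ℂ} (hE₀ : E₀.dim = 1)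
    (hell : EllipticTensorWeilTwistedCarriers E₀) : PadicSemiregularLift.HodgeAbelianVarieties := by
  obtain ⟨C⟩ := (hC : Nonempty ChernCharacterBetti)
  exact HC_AV_of_andre1996_of_door_of_cmAlgebraic_of_ellipticTensorWeilCarriers h₂₁ h₂₂
    ((twistedPerfectDoorVHC_iff_localVariationalHodgeFor C _).1 (hDoor C)) (hcm C) hE₀ (hell C)

/-! ## §3 Lattice: the elliptic-power node (every curve, all algebraic classes) dominates the Weil-tensor node (one curve, Weil classes) -/

/-- `EllipticPowerAlgebraicCarriers 𝒪 ⟹ EllipticTensorWeilCarriers 𝒪 E₀` for every elliptic curve `E₀` (road-side §3 at every `(n, p)`).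
[cite: vanGeemen1994HodgeAV, Lemma 3.7 and Thm. 4.3] [cite: Bloch1972Semiregularity, Remark (7.5)] -/
theorem ellipticTensorWeilCarriers_of_ellipticPowerAlgebraicCarriers {𝒪 : ObjClass} {E₀ : AbelianVariety ℂ} (hE₀ : E₀.dim = 1)
    (h : EllipticPowerAlgebraicCarriers 𝒪) : EllipticTensorWeilCarriers 𝒪 E₀ :=
  fun n p h2 h4 ↦ weilTensorCarrierAt_of_ellipticPowerAlgebraicCarrierAt hE₀ (h n p h2 h4)

/-- Twisted form: `EllipticPowerAlgebraicTwistedCarriers ⟹ EllipticTensorWeilTwistedCarriers E₀` (every `E₀`). [cite: Bloch1972Semiregularity, Remark (7.5)]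
[cite: Markman2025SecantWeil, §7.3] -/
theorem ellipticTensorWeilTwistedCarriers_of_ellipticPowerAlgebraicTwistedCarriers {E₀ : AbelianVariety ℂ} (hE₀ : E₀.dim = 1)
    (h : EllipticPowerAlgebraicTwistedCarriers) : EllipticTensorWeilTwistedCarriers E₀ :=
  fun C ↦ ellipticTensorWeilCarriers_of_ellipticPowerAlgebraicCarriers hE₀ (h C)

/-- `AbelianDesigns 𝒪 ⟹ EllipticTensorWeilCarriers 𝒪 E₀` (every `E₀`), through the elliptic-power-algebraic node (AB-d's
`ellipticPowerAlgebraicCarrierAt_of_pinnedDesignAt`). [cite: Bloch1972Semiregularity, Remark (7.5)] -/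
theorem ellipticTensorWeilCarriers_of_abelianDesigns {𝒪 : ObjClass} {E₀ : AbelianVariety ℂ} (hE₀ : E₀.dim = 1) (h : AbelianDesigns 𝒪) :
    EllipticTensorWeilCarriers 𝒪 E₀ :=
  ellipticTensorWeilCarriers_of_ellipticPowerAlgebraicCarriers hE₀ fun n p h2 h4 ↦ ellipticPowerAlgebraicCarrierAt_of_pinnedDesignAt (h n p h2 h4)

/-- **AB-f's `HC_CM` row recovered**: K-C ∧ door ∧ the Weil-tensor fact ∧ `EllipticPowerAlgebraicTwistedCarriers` ⟹ `HC_CM`, factoring through §1 at any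
elliptic curve (one exists: `HodgeTheory.exists_abelianVariety_dim_one_cupProduct_ne_zero`). [cite: Andre1996Motifs, §6.3 (pp. 32–33)] -/
theorem HC_CM_of_ellipticPowerAlgebraicTwistedCarriers_of_weilTensorPencils (hC : VHCAbelianSchemesRoad.ChernCharacterOnBetti)
    (hDoor : VHCAbelianSchemesRoad.TwistedPerfectDoor) (h₂₂ : andre1996_cmHodgeClasses_weilTensorPencils)
    (hB : EllipticPowerAlgebraicTwistedCarriers) : RankFourFaces.CMAbelianHodge := by
  obtain ⟨E₀, hE₀, -⟩ := exists_abelianVariety_dim_one_cupProduct_ne_zero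
  exact HC_CM_of_ellipticTensorWeilTwistedCarriers hC hDoor h₂₂ hE₀ (ellipticTensorWeilTwistedCarriers_of_ellipticPowerAlgebraicTwistedCarriers hE₀ hB)

/-! ## §4 The Weil-tensor fact discharges the road's binder #22 -/

/-- **The Weil-tensor fact discharges the road's binder #22** (`AndreAnchoredPencilsAlgebraic`). [cite: Andre1996Motifs, Lemmes 6.3.2–6.3.3 (pp. 32–33)] -/
theorem andreAnchoredPencilsAlgebraic_of_weilTensorPencils (h₂₂ : andre1996_cmHodgeClasses_weilTensorPencils) :
    VHCAbelianSchemesRoad.AndreAnchoredPencilsAlgebraic :=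
  andre1996_cmHodgeClasses_algebraicallyAnchoredPencils_of_weilTensorPencils h₂₂

end Summit.HodgeConjecture.HodgeConjecture.Ring2.AbelianAll

end
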